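import Summits.AnomalousDissipation.AnomalousDissipation.Theorems.SteadyCoherentFractionRootsPlanarWitnessDefect
import Literature.Analysis.FunctionSpaces.TorusSobolevSpaceProofs
import Literature.Analysis.FunctionSpaces.TorusFluidGlueProofs
import Literature.Analysis.FluidPDE.NSStrongSolutions2DProofs
import HarnessLib

/-!
# Non-planar steady roots at EVERY non-zero cross-flow
# (negative lane of `CoherentFraction.InvariantExtremeClimatesPlanar`, stmt-AnomalousDissipation-28074)

All crossed-shear kills of record (`RootsPlanar` 28522, `TameEulerClimatesPlanar` 27427,
`ExtremeClimatesPlanarBeyondFiniteModes` 27871, `InvariantExtremeClimatesPlanar` 28074) instantiate the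
drift at `m = c_K e₁`, `c_K = -1/(4π)`.  The drift parameter offers no refuge: the COMPONENT SCALING
`v_t = (v₀/t, t v₁, 0)` of the crossed-shear fluctuation `v = (v₀, v₁, 0)` (`…WitnessDefs`) is, for every
real `t ≠ 0`, a smooth mean-zero divergence-free classical root of `(v_t·∇)v_t + Dv_t·(t c_K e₁) + ∇p = f_K`
with the SAME pressure (`crossedShear_momentumT`: the profile `ρ(x₂)` and the factor `t` cancel), hence
a cylindrical steady root in `H ∩ V` with drift `t c_K e₁` (`root_identityT`, `exists_stateT`) whose
planar-symmetry defect is `≥ t² c_K²/16 > 0` in every horizontal lattice direction (`defect_stateT_ge`).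
As `t ↦ t c_K` is onto `ℝ ∖ {0}`: NON-PLANAR TAME STEADY ROOTS EXIST AT EVERY CROSS-FLOW `p e₁`, `p ≠ 0`
(`exists_nonplanar_root_of_ne_zero`) — a restatement of the refuted Liouville / climate items that
only restricts the vertical drift to `0 < |p| ≤ p₀` falls to the same mechanism (energy `∼ 1/(32π²p²)`,
enstrophy `∼ 1/(2p²)` as `p → 0`); only horizontal drifts `⟪m, e₁⟫ = 0` escape this family. [folklore]
-/

noncomputable section

-- `Summit.<Summit>.<Problem>` is the tree's mandated summit-side namespace (CONVENTIONS §2); for this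
-- single-conjunct summit the two segments coincide, so the duplicate is deliberate.
set_option linter.dupNamespace false

namespace Summit.AnomalousDissipation.AnomalousDissipation.Theorems.CrossedShearRoot

open Real MeasureTheory
open scoped InnerProductSpace
open Literature.Analysis.FunctionSpaces Literature.Analysis.FunctionSpaces.Torus Literature.Analysis.FluidPDE

/-- First component of the scaled fluctuation: `v₀/t`. [folklore] -/
def V0T (t : ℝ) : UnitAddTorus (Fin 3) → ℝ := fun x => t⁻¹ * V0 x

/-- Second component of the scaled fluctuation: `t v₁`. [folklore] -/
def V1T (t : ℝ) : UnitAddTorus (Fin 3) → ℝ := fun x => t * V1 x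

/-- The scaled crossed-shear fluctuation `v_t = (v₀/t, t v₁, 0)`. [folklore] -/
def vfieldT (t : ℝ) (x : UnitAddTorus (Fin 3)) : EuclideanSpace ℝ (Fin 3) :=
  V0T t x • EuclideanSpace.single (0 : Fin 3) (1 : ℝ) + V1T t x • EuclideanSpace.single (1 : Fin 3) (1 : ℝ)

/-- The scaled drift (cross-flow) `m_t = t c_K e₁`. [folklore] -/
def driftT (t : ℝ) : EuclideanSpace ℝ (Fin 3) := EuclideanSpace.single (1 : Fin 3) (t * cK)

variable (t : ℝ)

/-- `v₀/t` is smooth. [folklore] -/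
theorem isSmooth_V0T : IsSmooth (V0T t) := isSmooth_V0.smul t⁻¹

/-- `t v₁` is smooth. [folklore] -/
theorem isSmooth_V1T : IsSmooth (V1T t) := isSmooth_V1.smul t

/-- `v_t` is smooth. [folklore] -/
theorem isSmooth_vfieldT : IsSmooth (vfieldT t) :=
  ((isSmooth_V0T t).smul' (isSmooth_const _)).add ((isSmooth_V1T t).smul' (isSmooth_const _))

/-- Lift of `v₀/t`. [folklore] -/
theorem lift_V0T : lift (V0T t) = fun y : (EuclideanSpace ℝ (Fin 3)) => t⁻¹ * (c4 (y 1) / rho (y 2)) := by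
  funext y
  have h0 := congrFun lift_V0 y
  rw [lift_apply] at h0 ⊢
  simp only [V0T, h0]

/-- Lift of `t v₁`. [folklore] -/
theorem lift_V1T : lift (V1T t) = fun y : (EuclideanSpace ℝ (Fin 3)) => t * ((c4 (y 0) + cK) * rho (y 2) - cK) := by
  funext y
  have h1 := congrFun lift_V1 y
  rw [lift_apply] at h1 ⊢
  simp only [V1T, h1]

/-- Derivative of the lift of `v₀/t`. [folklore] -/
theorem fderiv_lift_V0T (y a : (EuclideanSpace ℝ (Fin 3))) :
    fderiv ℝ (lift (V0T t)) y a = t⁻¹ * fderiv ℝ (lift V0) y a := by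
  have d0 : DifferentiableAt ℝ (lift V0) y := (isSmooth_V0.contDiffAt.differentiableAt (by simp))
  have h := d0.hasFDerivAt.const_mul t⁻¹
  have key := h.congr_of_eventuallyEq (f₁ := lift (V0T t))
    (Filter.Eventually.of_forall fun z => by simp only [lift_apply, V0T])
  rw [key.fderiv]
  simp only [_root_.smul_apply, smul_eq_mul]

/-- Derivative of the lift of `t v₁`. [folklore] -/
theorem fderiv_lift_V1T (y a : (EuclideanSpace ℝ (Fin 3))) :
    fderiv ℝ (lift (V1T t)) y a = t * fderiv ℝ (lift V1) y a := by
  have d1 : DifferentiableAt ℝ (lift V1) y := (isSmooth_V1.contDiffAt.differentiableAt (by simp))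
  have h := d1.hasFDerivAt.const_mul t
  have key := h.congr_of_eventuallyEq (f₁ := lift (V1T t))
    (Filter.Eventually.of_forall fun z => by simp only [lift_apply, V1T])
  rw [key.fderiv]
  simp only [_root_.smul_apply, smul_eq_mul]

/-- Derivative of the lift of `v_t`, applied. [folklore] -/
theorem fderiv_lift_vfieldT (y a : (EuclideanSpace ℝ (Fin 3))) :
    fderiv ℝ (lift (vfieldT t)) y a =
      (t⁻¹ * fderiv ℝ (lift V0) y a) • EuclideanSpace.single (0 : Fin 3) (1 : ℝ) +
        (t * fderiv ℝ (lift V1) y a) • EuclideanSpace.single (1 : Fin 3) (1 : ℝ) := by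
  have d0 : DifferentiableAt ℝ (lift (V0T t)) y := ((isSmooth_V0T t).contDiffAt.differentiableAt (by simp))
  have d1 : DifferentiableAt ℝ (lift (V1T t)) y := ((isSmooth_V1T t).contDiffAt.differentiableAt (by simp))
  have h := (d0.hasFDerivAt.smul_const (EuclideanSpace.single (0 : Fin 3) (1 : ℝ))).add
    (d1.hasFDerivAt.smul_const (EuclideanSpace.single (1 : Fin 3) (1 : ℝ)))
  have key := h.congr_of_eventuallyEq (f₁ := lift (vfieldT t))
    (Filter.Eventually.of_forall fun z => by simp only [lift_apply, vfieldT, Pi.add_apply])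
  rw [key.fderiv]
  simp only [_root_.add_apply, ContinuousLinearMap.smulRight_apply, fderiv_lift_V0T, fderiv_lift_V1T]

/-- `D_T v_t (proj y) a = D(lift v_t)(y) a`, in components. [folklore] -/
theorem torusFderiv_vfieldT_proj (y a : (EuclideanSpace ℝ (Fin 3))) :
    Torus.fderiv (vfieldT t) (proj y) a =
      (t⁻¹ * fderiv ℝ (lift V0) y a) • EuclideanSpace.single (0 : Fin 3) (1 : ℝ) +
        (t * fderiv ℝ (lift V1) y a) • EuclideanSpace.single (1 : Fin 3) (1 : ℝ) := by
  rw [← fderiv_lift, fderiv_lift_vfieldT]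

/-- The values of `v_t` at `proj y`, coordinatewise. [folklore] -/
theorem vfieldT_proj_apply (y : (EuclideanSpace ℝ (Fin 3))) (i : Fin 3) :
    vfieldT t (proj y) i = (if i = 0 then t⁻¹ * (c4 (y 1) / rho (y 2)) else 0) +
      (if i = 1 then t * ((c4 (y 0) + cK) * rho (y 2) - cK) else 0) := by
  have h0 := congrFun (lift_V0T t) y
  have h1 := congrFun (lift_V1T t) y
  rw [lift_apply] at h0 h1
  simp only [vfieldT, h0, h1, PiLp.add_apply, PiLp.smul_apply, EuclideanSpace.single, PiLp.single_apply,
    smul_eq_mul, mul_ite, mul_one, mul_zero]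

/-- The components of `v_t` as scalar functions. [folklore] -/
theorem vfieldT_apply_zero : (fun z => vfieldT t z 0) = V0T t := by funext z; simp [vfieldT]

/-- The components of `v_t` as scalar functions. [folklore] -/
theorem vfieldT_apply_one : (fun z => vfieldT t z 1) = V1T t := by funext z; simp [vfieldT]

/-- The components of `v_t` as scalar functions. [folklore] -/
theorem vfieldT_apply_two : (fun z => vfieldT t z 2) = fun _ => 0 := by funext z; simp [vfieldT]


/-- `v_t` is divergence free. [folklore] -/
theorem isDivFree_vfieldT : IsDivFree (vfieldT t) := by
  intro x
  obtain ⟨y, rfl⟩ := proj_surjective x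
  unfold divergence
  rw [Fin.sum_univ_three, vfieldT_apply_zero, vfieldT_apply_one, vfieldT_apply_two,
    partialDeriv_proj (isSmooth_V0T t), partialDeriv_proj (isSmooth_V1T t), partialDeriv_const_zero,
    fderiv_lift_V0T, fderiv_lift_V1T, fderiv_lift_V0, fderiv_lift_V1]
  simp [EuclideanSpace.single]

/-- `∫ v_t = 0`. [folklore] -/
theorem hasZeroMean_vfieldT : HasZeroMean (vfieldT t) := by
  unfold HasZeroMean vfieldT
  rw [integral_add (((isSmooth_V0T t).smul' (isSmooth_const _)).integrable)
    (((isSmooth_V1T t).smul' (isSmooth_const _)).integrable), integral_smul_const, integral_smul_const]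
  have h0 := hasZeroMean_V0; have h1 := hasZeroMean_V1; unfold HasZeroMean at h0 h1
  have e0 : ∫ x, V0T t x = 0 := by unfold V0T; rw [integral_const_mul, h0, mul_zero]
  have e1 : ∫ x, V1T t x = 0 := by unfold V1T; rw [integral_const_mul, h1, mul_zero]
  rw [e0, e1, zero_smul, zero_smul, add_zero]

variable {t}

/-- **The classical steady equation in drift form for the scaled field**:
`(v_t·∇)v_t + Dv_t·(t c_K e₁) + ∇p = f_K` pointwise on `T³`, `t ≠ 0` — the scaling factor and the
profile cancel identically. [folklore] -/
theorem crossedShear_momentumT (ht : t ≠ 0) (x : (UnitAddTorus (Fin 3))) :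
    Torus.convect (vfieldT t) (vfieldT t) x + Torus.fderiv (vfieldT t) x (driftT t) + Torus.gradient pres x = fK x := by
  obtain ⟨y, rfl⟩ := proj_surjective x
  have hρ : rho (y 2) ≠ 0 := (rho_profile_pos _).1.ne'
  have hf : fK (proj y) = lift fK y := (lift_apply fK y).symm
  unfold Torus.convect
  ext i
  rw [hf, lift_fK]
  simp only [PiLp.add_apply, torusFderiv_vfieldT_proj, torusGradient_proj_apply, fderiv_lift_V0, fderiv_lift_V1,
    fderiv_lift_pres, vfieldT_proj_apply, driftT, PiLp.smul_apply, EuclideanSpace.single, PiLp.single_apply, smul_eq_mul]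
  have hK := four_pi_mul_cK
  fin_cases i
  · simp
    field_simp
    linear_combination (-(s4 (y 1) * rho (y 2))) * hK
  · simp
    field_simp
    ring
  · simp


/-- The representative function `𝕋³ → ℝ³` of a state `W ∈ H`. [folklore] -/
abbrev rep (W : Literature.Analysis.FunctionSpaces.Torus.energySpace (Fin 3)) :
    (UnitAddTorus (Fin 3)) → (EuclideanSpace ℝ (Fin 3)) :=
  ((W : Lp (EuclideanSpace ℝ (Fin 3)) 2 (volume : Measure (UnitAddTorus (Fin 3)))) :
    (UnitAddTorus (Fin 3)) → (EuclideanSpace ℝ (Fin 3)))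

/-- `v_t` represents a state of `H` of finite enstrophy (`V`). [folklore] -/
theorem exists_stateT (t : ℝ) :
    ∃ W : Literature.Analysis.FunctionSpaces.Torus.energySpace (Fin 3), rep W =ᵐ[volume] vfieldT t ∧
        (W : Lp (EuclideanSpace ℝ (Fin 3)) 2 (volume : Measure (UnitAddTorus (Fin 3)))) ∈ Literature.Analysis.FunctionSpaces.Torus.energySpaceV (Fin 3) := by
  have hmem : ((isSmooth_vfieldT t).memLp 2).toLp (vfieldT t) ∈ Torus.smoothSolenoidal (Fin 3) :=
    ⟨vfieldT t, isSmooth_vfieldT t, isDivFree_vfieldT t, hasZeroMean_vfieldT t, MemLp.coeFn_toLp ((isSmooth_vfieldT t).memLp 2)⟩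
  exact ⟨⟨((isSmooth_vfieldT t).memLp 2).toLp (vfieldT t), Torus.smoothSolenoidal_subset_energySpace hmem⟩,
    MemLp.coeFn_toLp ((isSmooth_vfieldT t).memLp 2), Torus.smoothSolenoidal_subset_energySpaceV_holds hmem⟩

/-- **The cylindrical root identity with drift `t c_K e₁`.** For every state `W` represented by `v_t`
(`t ≠ 0`) and every smooth divergence-free test field `w`:
`(f_K, w) + (W, (m_t·∇)w) + ∫⟪(W·∇)w, W⟫ = 0`. [folklore] -/
theorem root_identityT (ht : t ≠ 0) {W : (UnitAddTorus (Fin 3)) → (EuclideanSpace ℝ (Fin 3))} (hW : W =ᵐ[volume] vfieldT t)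
    {w : (UnitAddTorus (Fin 3)) → (EuclideanSpace ℝ (Fin 3))} (hw : IsSmooth w) (hwd : IsDivFree w) :
    (∫ x, ⟪fK x, w x⟫_ℝ) + (∫ x, ⟪W x, Torus.fderiv w x (driftT t)⟫_ℝ) +
      (∫ x, ⟪Torus.fderiv w x (W x), W x⟫_ℝ) = 0 := by
  have hv := isSmooth_vfieldT t
  have e1 : ∫ x, ⟪W x, Torus.fderiv w x (driftT t)⟫_ℝ = ∫ x, ⟪vfieldT t x, Torus.fderiv w x (driftT t)⟫_ℝ :=
    integral_congr_ae (by filter_upwards [hW] with x hx; rw [hx])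
  have e2 : ∫ x, ⟪Torus.fderiv w x (W x), W x⟫_ℝ = ∫ x, ⟪Torus.fderiv w x (vfieldT t x), vfieldT t x⟫_ℝ :=
    integral_congr_ae (by filter_upwards [hW] with x hx; rw [hx])
  have ibp1 : ∫ x, ⟪Torus.fderiv w x (vfieldT t x), vfieldT t x⟫_ℝ =
      -∫ x, ⟪Torus.convect (vfieldT t) (vfieldT t) x, w x⟫_ℝ := by
    have h := Torus.integral_inner_convect_eq_neg hv (isDivFree_vfieldT t) hw hv
    change ∫ x, ⟪Torus.convect (vfieldT t) w x, vfieldT t x⟫_ℝ = _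
    rw [h]
    congr 1
    exact integral_congr_ae (ae_of_all _ fun x => real_inner_comm _ _)
  have ibp2 : ∫ x, ⟪vfieldT t x, Torus.fderiv w x (driftT t)⟫_ℝ =
      -∫ x, ⟪Torus.fderiv (vfieldT t) x (driftT t), w x⟫_ℝ := by
    have hc : IsDivFree (fun _ : (UnitAddTorus (Fin 3)) => driftT t) := by
      intro x; unfold divergence; simp [Torus.partialDeriv, Torus.lineDeriv]
    have h := Torus.integral_inner_convect_eq_neg (isSmooth_const (driftT t)) hc hv hw
    change ∫ x, ⟪Torus.fderiv (vfieldT t) x (driftT t), w x⟫_ℝ = -∫ x, ⟪vfieldT t x, Torus.fderiv w x (driftT t)⟫_ℝ at h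
    linarith
  have hDm : IsSmooth fun x => Torus.fderiv (vfieldT t) x (driftT t) := (isSmooth_const (driftT t)).convect hv
  have mom : ∫ x, ⟪fK x, w x⟫_ℝ = (∫ x, ⟪Torus.convect (vfieldT t) (vfieldT t) x, w x⟫_ℝ) +
      ∫ x, ⟪Torus.fderiv (vfieldT t) x (driftT t), w x⟫_ℝ := by
    have hp := integral_inner_gradient_eq_zero_of_isDivFree hw isSmooth_pres hwd
    have i1 : Integrable (fun x => ⟪Torus.convect (vfieldT t) (vfieldT t) x, w x⟫_ℝ) volume :=
      ((hv.convect hv).inner hw).integrable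
    have i2 : Integrable (fun x => ⟪Torus.fderiv (vfieldT t) x (driftT t), w x⟫_ℝ) volume := (hDm.inner hw).integrable
    have i3 : Integrable (fun x => ⟪Torus.gradient pres x, w x⟫_ℝ) volume := (isSmooth_pres.gradient.inner hw).integrable
    have i12 : Integrable (fun x => ⟪Torus.convect (vfieldT t) (vfieldT t) x, w x⟫_ℝ +
        ⟪Torus.fderiv (vfieldT t) x (driftT t), w x⟫_ℝ) volume := i1.add i2
    calc ∫ x, ⟪fK x, w x⟫_ℝ
        = ∫ x, (⟪Torus.convect (vfieldT t) (vfieldT t) x, w x⟫_ℝ + ⟪Torus.fderiv (vfieldT t) x (driftT t), w x⟫_ℝ +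
            ⟪Torus.gradient pres x, w x⟫_ℝ) := by
          refine integral_congr_ae (ae_of_all _ fun x => ?_)
          show ⟪fK x, w x⟫_ℝ = _
          rw [← crossedShear_momentumT ht x, inner_add_left, inner_add_left]
      _ = (∫ x, ⟪Torus.convect (vfieldT t) (vfieldT t) x, w x⟫_ℝ) +
            (∫ x, ⟪Torus.fderiv (vfieldT t) x (driftT t), w x⟫_ℝ) +
            ∫ x, ⟪Torus.gradient pres x, w x⟫_ℝ := by rw [integral_add i12 i3, integral_add i1 i2]
      _ = _ := by rw [hp, add_zero]
  rw [e1, e2, ibp1, ibp2, mom]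
  ring


/-- The second component of the increment of `v_t`: `t (v₁(x+h) - v₁(x))`. [folklore] -/
theorem vfieldT_increment_apply_one (t : ℝ) (h x : (UnitAddTorus (Fin 3))) :
    (vfieldT t (x + h) - vfieldT t x) 1 = t * (V1 (x + h) - V1 x) := by
  simp [vfieldT, V1T, mul_sub]

/-- One-mode lower bound for the scaled field:
`∫ ‖v_t(x + h) - v_t(x)‖² dx ≥ t² ‖e_k(h) - 1‖² ‖𝓕v₁(k)‖²`. [folklore] -/
theorem integral_increment_sq_geT (t : ℝ) (h : (UnitAddTorus (Fin 3))) (k : Fin 3 → ℤ) :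
    t ^ 2 * (‖UnitAddTorus.mFourier k h - 1‖ ^ 2 *
      ‖UnitAddTorus.mFourierCoeff (fun x : (UnitAddTorus (Fin 3)) => (V1 x : ℂ)) k‖ ^ 2) ≤
      ∫ x, ‖vfieldT t (x + h) - vfieldT t x‖ ^ 2 := by
  set w : (UnitAddTorus (Fin 3)) → (EuclideanSpace ℝ (Fin 3)) := fun x => vfieldT t (x + h) - vfieldT t x with hw_def
  have hw : IsSmooth w := ((isSmooth_vfieldT t).comp_add_right h).sub (isSmooth_vfieldT t)
  have hsum := Torus.hasSum_sq_norm_mFourierCoeff_complexify (hw.memLp 2)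
  have h1 : ‖UnitAddTorus.mFourierCoeff (EuclideanSpace.complexify ∘ w) k‖ ^ 2 ≤ ∫ x, ‖w x‖ ^ 2 :=
    le_hasSum hsum k fun j _ => sq_nonneg _
  have hint : Integrable (EuclideanSpace.complexify ∘ w) volume :=
    (EuclideanSpace.complexify.continuous.comp hw.continuous).integrable_unitAddTorus
  have h2 : UnitAddTorus.mFourierCoeff (EuclideanSpace.complexify ∘ w) k 1 =
      UnitAddTorus.mFourierCoeff ((t : ℂ) • fun x : (UnitAddTorus (Fin 3)) => ((V1 (x + h) : ℂ) - (V1 x : ℂ))) k := by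
    rw [Torus.mFourierCoeff_apply_euclidean hint k 1]
    congr 1
    funext x
    simp only [Function.comp_apply, EuclideanSpace.complexify_apply, hw_def, vfieldT_increment_apply_one,
      Complex.ofReal_mul, Complex.ofReal_sub, Pi.smul_apply, smul_eq_mul]
  have h3 : UnitAddTorus.mFourierCoeff ((t : ℂ) • fun x : (UnitAddTorus (Fin 3)) => ((V1 (x + h) : ℂ) - (V1 x : ℂ))) k =
      (t : ℂ) • ((UnitAddTorus.mFourier k h - 1) • UnitAddTorus.mFourierCoeff (fun x : (UnitAddTorus (Fin 3)) => (V1 x : ℂ)) k) := by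
    rw [Torus.mFourierCoeff_const_smul, Torus.mFourierCoeff_comp_add_right_sub integrable_V1_complex h k]
  have h4 : ‖UnitAddTorus.mFourierCoeff (EuclideanSpace.complexify ∘ w) k 1‖ ^ 2 ≤
      ‖UnitAddTorus.mFourierCoeff (EuclideanSpace.complexify ∘ w) k‖ ^ 2 := by
    rw [EuclideanSpace.norm_sq_eq]
    exact Finset.single_le_sum (f := fun i => ‖UnitAddTorus.mFourierCoeff (EuclideanSpace.complexify ∘ w) k i‖ ^ 2)
      (fun i _ => sq_nonneg _) (Finset.mem_univ 1)
  rw [h2, h3, norm_smul, norm_smul, Complex.norm_real, Real.norm_eq_abs, mul_pow, mul_pow, sq_abs] at h4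
  exact h4.trans h1

/-- `s ↦ ∫ ‖v_t(x + h_s) - v_t(x)‖² dx` is continuous. [folklore] -/
theorem continuous_integral_increment_sqT (t : ℝ) (a b : ℤ) :
    Continuous fun s : ℝ => ∫ x, ‖vfieldT t (x + Literature.Analysis.FluidPDE.toTorus
      (fun i => s * (![(a : ℝ), 0, (b : ℝ)] : Fin 3 → ℝ) i)) - vfieldT t x‖ ^ 2 := by
  have hv : Continuous (vfieldT t) := (isSmooth_vfieldT t).continuous
  obtain ⟨C, hC⟩ : ∃ C, ∀ x, ‖vfieldT t x‖ ≤ C :=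
    (isCompact_univ.exists_bound_of_continuousOn hv.continuousOn).imp fun C hC x => hC x (Set.mem_univ _)
  have hsh := continuous_hshift a b
  refine continuous_of_dominated (bound := fun _ => (C + C) ^ 2) ?_ ?_ (integrable_const _) ?_
  · intro s
    exact (((hv.comp (continuous_id.add continuous_const)).sub hv).norm.pow 2).aestronglyMeasurable
  · intro s
    refine ae_of_all _ fun x => ?_
    rw [Real.norm_eq_abs, abs_pow, abs_norm]
    have h1 : ‖vfieldT t (x + Literature.Analysis.FluidPDE.toTorus (fun i => s * (![(a : ℝ), 0, (b : ℝ)] : Fin 3 → ℝ) i)) -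
        vfieldT t x‖ ≤ C + C := (norm_sub_le _ _).trans (add_le_add (hC _) (hC _))
    exact pow_le_pow_left₀ (norm_nonneg _) h1 2
  · refine ae_of_all _ fun x => ?_
    exact ((hv.comp (continuous_const.add hsh)).sub continuous_const).norm.pow 2

/-- **Defect lower bound for the scaled field.** For every `(a, b) ≠ (0, 0)`:
`t² c_K²/16 ≤ ½∫₀¹ ∫ ‖v_t(x + s(a,0,b)) - v_t(x)‖² dx ds`. [folklore] -/
theorem defect_vfieldT_ge (t : ℝ) (a b : ℤ) (hab : (a, b) ≠ (0, 0)) :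
    t ^ 2 * (cK ^ 2 / 16) ≤ (1 / 2 : ℝ) * ∫ s in (0 : ℝ)..1, ∫ x, ‖vfieldT t (x + Literature.Analysis.FluidPDE.toTorus
      (fun i => s * (![(a : ℝ), 0, (b : ℝ)] : Fin 3 → ℝ) i)) - vfieldT t x‖ ^ 2 := by
  obtain ⟨k, n, hn, hk, hcoef⟩ : ∃ (k : Fin 3 → ℤ) (n : ℤ), n ≠ 0 ∧ (k 0 * a + k 2 * b = n) ∧
      cK ^ 2 / 16 ≤ ‖UnitAddTorus.mFourierCoeff (fun x : (UnitAddTorus (Fin 3)) => (V1 x : ℂ)) k‖ ^ 2 := by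
    by_cases hb : b = 0
    · subst hb
      have ha : a ≠ 0 := fun ha => hab (by rw [ha])
      refine ⟨![2, 0, 0], 2 * a, mul_ne_zero two_ne_zero ha, by simp, ?_⟩
      rw [mFourierCoeff_V1_two]
      norm_num
      linarith [cK_sq_div_le]
    · refine ⟨![0, 0, 1], b, hb, by simp, ?_⟩
      rw [mFourierCoeff_V1_one, norm_div, Complex.norm_real, Real.norm_eq_abs, div_pow, sq_abs]
      norm_num
  have hpt : ∀ s : ℝ, (t ^ 2 * (cK ^ 2 / 16)) * (2 - 2 * Real.cos (2 * π * (s * n))) ≤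
      ∫ x, ‖vfieldT t (x + Literature.Analysis.FluidPDE.toTorus (fun i => s * (![(a : ℝ), 0, (b : ℝ)] : Fin 3 → ℝ) i)) -
        vfieldT t x‖ ^ 2 := by
    intro s
    have h := integral_increment_sq_geT t (Literature.Analysis.FluidPDE.toTorus
      (fun i => s * (![(a : ℝ), 0, (b : ℝ)] : Fin 3 → ℝ) i)) k
    rw [mFourier_hshift, show (s * (k 0 * a + k 2 * b) : ℝ) = s * n by rw [← hk]; push_cast; ring,
      norm_exp_sub_one_sq] at h
    have h0 : 0 ≤ 2 - 2 * Real.cos (2 * π * (s * n)) := by linarith [Real.cos_le_one (2 * π * (s * n))]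
    calc t ^ 2 * (cK ^ 2 / 16) * (2 - 2 * Real.cos (2 * π * (s * ↑n)))
        = t ^ 2 * ((cK ^ 2 / 16) * (2 - 2 * Real.cos (2 * π * (s * ↑n)))) := by ring
      _ ≤ t ^ 2 * (‖UnitAddTorus.mFourierCoeff (fun x : (UnitAddTorus (Fin 3)) => (V1 x : ℂ)) k‖ ^ 2 *
            (2 - 2 * Real.cos (2 * π * (s * ↑n)))) :=
          mul_le_mul_of_nonneg_left (mul_le_mul_of_nonneg_right hcoef h0) (sq_nonneg t)
      _ ≤ _ := by rw [mul_comm (‖_‖ ^ 2)]; exact h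
  have hi1 : IntervalIntegrable (fun s : ℝ => t ^ 2 * (cK ^ 2 / 16) * (2 - 2 * Real.cos (2 * π * (s * n))))
      MeasureTheory.volume 0 1 :=
    (by fun_prop : Continuous fun s : ℝ => t ^ 2 * (cK ^ 2 / 16) * (2 - 2 * Real.cos (2 * π * (s * n)))).intervalIntegrable _ _
  have hi2 := (continuous_integral_increment_sqT t a b).intervalIntegrable (μ := MeasureTheory.volume) 0 1
  have hmono := intervalIntegral.integral_mono_on zero_le_one hi1 hi2 fun s _ => hpt s
  rw [intervalIntegral.integral_const_mul, integral_two_sub_two_cos hn] at hmono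
  linarith

/-- The defect integrals of a state represented by `v_t` are those of `v_t`. [folklore] -/
theorem integral_increment_sq_congrT {t : ℝ} {W : (UnitAddTorus (Fin 3)) → (EuclideanSpace ℝ (Fin 3))}
    (hW : W =ᵐ[volume] vfieldT t) (h : (UnitAddTorus (Fin 3))) :
    ∫ x, ‖W (x + h) - W x‖ ^ 2 = ∫ x, ‖vfieldT t (x + h) - vfieldT t x‖ ^ 2 := by
  have hsh : (fun x => W (x + h)) =ᵐ[volume] fun x => vfieldT t (x + h) :=
    (measurePreserving_add_right volume h).quasiMeasurePreserving.ae_eq_comp hW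
  refine integral_congr_ae ?_
  filter_upwards [hW, hsh] with x hx hxh
  rw [hx, hxh]

/-- **The scaled state is not planar**: for every state represented by `v_t` and every `p ∈ ℤ² ∖ 0`,
`½∫₀¹∫‖W(· + s p̂) − W‖² ≥ t² c_K²/16`. [folklore] -/
theorem defect_stateT_ge {t : ℝ} {W : (UnitAddTorus (Fin 3)) → (EuclideanSpace ℝ (Fin 3))}
    (hW : W =ᵐ[volume] vfieldT t) (p : {p : ℤ × ℤ // p ≠ 0}) :
    t ^ 2 * (cK ^ 2 / 16) ≤ (1 / 2 : ℝ) * ∫ s in (0 : ℝ)..1, ∫ x, ‖W (x + Literature.Analysis.FluidPDE.toTorus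
      (fun i => s * (![((p.1.1 : ℤ) : ℝ), 0, ((p.1.2 : ℤ) : ℝ)] : Fin 3 → ℝ) i)) - W x‖ ^ 2 := by
  have hp : (p.1.1, p.1.2) ≠ (0, 0) := by
    obtain ⟨⟨a, b⟩, hab⟩ := p
    simpa using hab
  have h := defect_vfieldT_ge t p.1.1 p.1.2 hp
  simp_rw [integral_increment_sq_congrT hW]
  exact h


/-- **NON-PLANAR STEADY ROOTS AT EVERY NON-ZERO CROSS-FLOW.**  For every `p ≠ 0` there is a state
`W ∈ H ∩ V` which is a cylindrical steady root of Euler + drift `p e₁` + `f_K` (root identity against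
every smooth divergence-free test field) and whose planar-symmetry defect is `≥ p²/16 > 0` in every
horizontal lattice direction.  Witness: the scaled crossed-shear field `v_t`, `t = p / c_K`. [folklore] -/
theorem exists_nonplanar_root_of_ne_zero (p : ℝ) (hp : p ≠ 0) :
    ∃ W : Literature.Analysis.FunctionSpaces.Torus.energySpace (Fin 3),
      Literature.Analysis.FunctionSpaces.Torus.eGradNormSq (rep W) < ⊤ ∧
      (∀ w : (UnitAddTorus (Fin 3)) → (EuclideanSpace ℝ (Fin 3)), IsSmooth w → IsDivFree w →
        (∫ x, ⟪fK x, w x⟫_ℝ) + (∫ x, ⟪rep W x, Torus.fderiv w x (EuclideanSpace.single (1 : Fin 3) p)⟫_ℝ) +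
          (∫ x, ⟪Torus.fderiv w x (rep W x), rep W x⟫_ℝ) = 0) ∧
      (∀ q : {q : ℤ × ℤ // q ≠ 0}, p ^ 2 / 16 ≤ (1 / 2 : ℝ) * ∫ s in (0 : ℝ)..1, ∫ x,
        ‖rep W (x + Literature.Analysis.FluidPDE.toTorus (fun i => s * (![((q.1.1 : ℤ) : ℝ), 0, ((q.1.2 : ℤ) : ℝ)] : Fin 3 → ℝ) i)) -
          rep W x‖ ^ 2) := by
  have hcK : cK ≠ 0 := fun h0 => by have h := four_pi_mul_cK; rw [h0, mul_zero] at h; norm_num at h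
  set t : ℝ := p / cK with ht_def
  have ht : t ≠ 0 := div_ne_zero hp hcK
  have htc : t * cK = p := by rw [ht_def]; field_simp
  obtain ⟨W, hW, hV⟩ := exists_stateT t
  refine ⟨W, Literature.Analysis.FluidPDE.eGradNormSq_lt_top_of_memSobolev_one hV.2, fun w hw hwd => ?_, fun q => ?_⟩
  · have h := root_identityT ht hW hw hwd
    simpa only [driftT, htc] using h
  · have e : p ^ 2 / 16 = t ^ 2 * (cK ^ 2 / 16) := by rw [← htc]; ring
    exact e ▸ defect_stateT_ge hW q

end Summit.AnomalousDissipation.AnomalousDissipation.Theorems.CrossedShearRoot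

end
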